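import Mathlib
import HarnessLib
import Summits.NavierStokesRegularity.NavierStokesRegularity.Theorems.TaylorModelRungThreeCertificateFormatVCoreNode
import Summits.NavierStokesRegularity.NavierStokesRegularity.Theorems.TaylorModelRungThreeCertificateCoreStepSoundB

/-!
# Crux K1b-DR (stmt-NavierStokesRegularity-23954), line `taylor-model` — v3 certificate SOUNDNESS, core side part 2: the
# six SUB-STEP conjuncts of `ChainVCore` from typer g32's `coreStep` soundness, and the assembly
# `chainVCore_of_checks` / `chainV_of_checks` (successor engine-1 g67)

The per-sub-step core output of the interpreted certificate is `coreVW j s = TV.base.coreStep ci` for SOME attempt `ci` of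
the retry (same boxes, orders and weight enclosures, only `L1` varies) — `coreVW_eq_coreStep`. Typer g32's
`…CoreStepSoundA/B` give, for `(T.coreStep ci).ok = true` under `CoefOK`, `CoefBoxOK`, `mt = monosTable` and the weight
enclosures (here discharged from the exact table scalars by `mem_ofQS2`: `κ_j·ω_k`, `ω_k`, `ω_k⁻¹`), the clauses (E2), (J),
(D1κ) ×3, (V1) ×3, (JU), (M) in window vocabulary; this file instantiates them at `cd := toCertDataVW`, `bx := toBoxesW`
(all field identities are `rfl`; the hull-2 box of `bx` IS the box `hull2` the core ran on) and assembles, with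
`…FormatVCoreNode` (a-block, bookkeeping) and `…FormatVRadiiSound`, the theorems
`chainVCore_of_checks : KitOK → ChecksOK → CoreChecksOK → ChainVCore cd bx` and
`chainV_of_checks : … → EntryOK → ChainV cd bx rd`.

MODEL-lattice bookkeeping only (rung TL-M3); nothing here is a statement about the Navier–Stokes equations.
-/

-- the sub-problem namespace repeats the summit name by design (D-0017)
set_option linter.dupNamespace false

namespace Summit.NavierStokesRegularity.NavierStokesRegularity.Theorems.TaylorModelCert

open scoped BigOperators
open Set
open Literature.Analysis.FluidPDE.TaoCascade Literature.Analysis.FluidPDE.TaoCascade.TaylorChain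
open Summit.NavierStokesRegularity.NavierStokesRegularity.Theorems.TaylorModelReadout
open Summit.NavierStokesRegularity.NavierStokesRegularity.Theorems.TaylorModelV

namespace CertTablesV

variable (TV : CertTablesV) (kitOf : ℕ → CoreKit)

/-- The kit hypotheses (coefficient tables sound, boxes sound, monomial table exact). [folklore] -/
structure KitOK : Prop where
  /-- the effective coefficients are the real field coefficients -/
  coef : TV.base.CoefOK QS2.toRealHom
  /-- the coefficient boxes enclose them -/
  box : ∀ j, CertTables.CoefBoxOK QS2.toRealHom TV.base (kitOf j).coefB
  /-- the monomial table is the active table -/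
  mt : ∀ j, (kitOf j).mt = TV.base.monosTable (kitOf j).coefB

variable {TV kitOf} {wT : ℕ → Array Dyad} {sc : ScalarsV}

/-- `TwinOK` from the kit hypotheses. [folklore] -/
theorem twinOK_of_kitOK (hk : KitOK TV kitOf) : TwinOK TV kitOf := fun j => by
  rw [hk.mt j]
  exact TV.base.isFieldEnclosureA_qBboxMA hk.coef (hk.box j) TV.prec

/-- The core-step input of stage `j` at hull `H2`, step `h`, row factor `L1`. [folklore] -/
def ciOf (TV : CertTablesV) (kitOf : ℕ → CoreKit) (j : ℕ) (H2 : Array IntervalD) (h L1 : Dyad) : CoreIn :=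
  { coefB := (kitOf j).coefB, mt := (kitOf j).mt, prec := TV.prec, p := TV.base.pdeg, pV := TV.pdegV, infl := (kitOf j).infl,
    H2 := H2, h := h, κωB := TV.κωB j, ωB := TV.ωB j, ωinvB := TV.ωinvB j, L1 := L1 }

/-- The core output `(j,s)` is ONE attempt of `coreStep` on the outer hull box and the step size. [folklore] -/
theorem coreVW_eq_coreStep (j s : ℕ) : ∃ L1 : Dyad,
    TV.coreVW kitOf wT j s = TV.base.coreStep (ciOf TV kitOf j ((TV.ctxOfW kitOf wT j).hull2 (TV.nodeVW kitOf wT j s) s) (TV.hD j s) L1) := by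
  obtain ⟨L1, hL⟩ := coreRetry_eq (TV.ctxOfW kitOf wT j) ((TV.ctxOfW kitOf wT j).hull2 (TV.nodeVW kitOf wT j s) s) (TV.hD j s)
  exact ⟨L1, hL⟩

/-! ### The weight enclosures from the exact table scalars -/

section Weights

/-- `cd.ω j k = toRealHom (wgt j (idx i k))` on the window. [folklore] -/
theorem cd_omega (j : ℕ) (i : Fin 4) {k : ℤ} (hk : -TV.base.Kb ≤ k ∧ k ≤ TV.base.Ka) :
    (TV.toCertDataVW kitOf wT sc).ω j k = QS2.toRealHom (TV.base.wgt j (TV.base.idx i k)) :=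
  TV.base.omega_of_InW QS2.toRealHom j i hk

/-- `cd.κ j = toRealHom (stage j).κ`. [folklore] -/
theorem cd_kappa (j : ℕ) : (TV.toCertDataVW kitOf wT sc).κ j = QS2.toRealHom (TV.base.stage j).κ := rfl

/-- `κ_j·ω_k ∈ κωB[idx i k]`. [folklore] -/
theorem mem_κωB (j : ℕ) (i : Fin 4) (k : ℤ) (hk1 : -TV.base.Kb ≤ k) (hk2 : k ≤ TV.base.Ka) :
    IntervalD.mem ((TV.toCertDataVW kitOf wT sc).κ j * (TV.toCertDataVW kitOf wT sc).ω j k)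
      (IntervalD.aget (TV.κωB j) (TV.base.idx i k)) := by
  rw [cd_omega j i ⟨hk1, hk2⟩, cd_kappa]
  unfold κωB
  rw [IntervalD.aget_ofFn _ (TV.base.idx_lt_n i ⟨hk1, hk2⟩)]
  exact IntervalD.mem_mulR TV.prec (IntervalD.mem_ofQS2 _ _) (IntervalD.mem_ofQS2 _ _)

/-- `ω_k ∈ ωB[idx i k]`. [folklore] -/
theorem mem_ωB (j : ℕ) (i : Fin 4) (k : ℤ) (hk1 : -TV.base.Kb ≤ k) (hk2 : k ≤ TV.base.Ka) :
    IntervalD.mem ((TV.toCertDataVW kitOf wT sc).ω j k) (IntervalD.aget (TV.ωB j) (TV.base.idx i k)) := by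
  rw [cd_omega j i ⟨hk1, hk2⟩]
  unfold ωB
  rw [IntervalD.aget_ofFn _ (TV.base.idx_lt_n i ⟨hk1, hk2⟩)]
  exact IntervalD.mem_ofQS2 _ _

/-- `ω_k⁻¹ ∈ ωinvB[idx i k]`. [folklore] -/
theorem mem_ωinvB (j : ℕ) (i : Fin 4) (k : ℤ) (hk1 : -TV.base.Kb ≤ k) (hk2 : k ≤ TV.base.Ka) :
    IntervalD.mem (((TV.toCertDataVW kitOf wT sc).ω j k)⁻¹) (IntervalD.aget (TV.ωinvB j) (TV.base.idx i k)) := by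
  rw [cd_omega j i ⟨hk1, hk2⟩, ← map_inv₀]
  unfold ωinvB
  rw [IntervalD.aget_ofFn _ (TV.base.idx_lt_n i ⟨hk1, hk2⟩)]
  exact IntervalD.mem_ofQS2 _ _

end Weights

/-! ### The hull-2 box of `toBoxesW` is the box the core ran on -/

section Hull

/-- Lower ends. [folklore] -/
theorem vecF_loR_hull2 (j s : ℕ) :
    TV.base.vecF (IntervalD.loR ((TV.ctxOfW kitOf wT j).hull2 (TV.nodeVW kitOf wT j s) s)) = (TV.toBoxesW kitOf wT).hlo 2 j s := by
  funext i k
  rw [bx_hlo, TV.base.vecF_apply, TV.base.vecF_apply]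
  split_ifs with hk
  · have hc := TV.base.idx_lt_n i hk
    unfold IntervalD.loR StageCtx.hull2 boxAround loOf vre
    rw [ctx_n, IntervalD.aget_ofFn _ hc, Dyad.toReal_sub]
    rfl
  · rfl

/-- Upper ends. [folklore] -/
theorem vecF_hiR_hull2 (j s : ℕ) :
    TV.base.vecF (IntervalD.hiR ((TV.ctxOfW kitOf wT j).hull2 (TV.nodeVW kitOf wT j s) s)) = (TV.toBoxesW kitOf wT).hhi 2 j s := by
  funext i k
  rw [bx_hhi, TV.base.vecF_apply, TV.base.vecF_apply]
  split_ifs with hk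
  · have hc := TV.base.idx_lt_n i hk
    unfold IntervalD.hiR StageCtx.hull2 boxAround hiOf vre
    rw [ctx_n, IntervalD.aget_ofFn _ hc, Dyad.toReal_add]
    rfl
  · rfl

/-- The hull box has size `n`. [folklore] -/
theorem size_hull2 (j s : ℕ) : ((TV.ctxOfW kitOf wT j).hull2 (TV.nodeVW kitOf wT j s) s).size = TV.base.n := by
  unfold StageCtx.hull2 boxAround; rw [Array.size_ofFn]; rfl

end Hull

/-! ### The sub-step conjuncts -/

section Sub

/-- **The ten core sub-step conjuncts of `ChainVCore`** ((E) as its second disjunct, (J), (D1κ)×3, (V1)×3, (JU), (M)) for the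
interpreted records at a passing sub-step. [folklore] -/
theorem coreClauses_of_checks (hk : KitOK TV kitOf) (hC : ChecksOK TV kitOf wT) {j : ℕ} (hj : j ≤ TV.base.N₀) {s : ℕ}
    (hs : s < TV.S j) :
    let cd := TV.toCertDataVW kitOf wT sc
    let bx := TV.toBoxesW kitOf wT
    ((∀ z, InBox cd (bx.hlo 2 j s) (bx.hhi 2 j s) z → InBox cd (bx.lo j s) (bx.hi j s) z ∧
          ∀ y, InBox cd (bx.lo j s) (bx.hi j s) y → ∀ u ∈ Icc 0 (cd.h j s),
            InBox cd (bx.lo j s) (bx.hi j s) (z + u • cd.Qb y y)) ∨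
        (∀ z, InBox cd (bx.hlo 2 j s) (bx.hhi 2 j s) z → ∀ u ∈ Icc 0 (cd.h j s), ∀ i k, -cd.Kb ≤ k → k ≤ cd.Ka →
          bx.lo j s i k < (∑ n ∈ Finset.range (cd.pdeg + 1), taylorJet cd.Qb z n i k * u ^ n)
              - bx.J j s i k * u ^ (cd.pdeg + 1) ∧
          (∑ n ∈ Finset.range (cd.pdeg + 1), taylorJet cd.Qb z n i k * u ^ n)
              + bx.J j s i k * u ^ (cd.pdeg + 1) < bx.hi j s i k)) ∧
      (∀ y, InTube cd bx j s y → ∀ i k, -cd.Kb ≤ k → k ≤ cd.Ka →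
        |taylorJet cd.Qb y (cd.pdeg + 1) i k| ≤ bx.J j s i k) ∧
      (∀ i k, -cd.Kb ≤ k → k ≤ cd.Ka → bx.loK j s i k ≤ 0 ∧ 0 ≤ bx.hiK j s i k ∧
        bx.loK j s i k ≤ -(cd.κ j * cd.ω j k) ∧ cd.κ j * cd.ω j k ≤ bx.hiK j s i k) ∧
      (∀ d₀ : Fin 4 → ℤ → ℝ, cd.InBall j d₀ (cd.κ j) →
        ∀ y d, InTube cd bx j s y → InBox cd (bx.loK j s) (bx.hiK j s) d → ∀ u ∈ Icc 0 (cd.h j s),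
          InBox cd (bx.loK j s) (bx.hiK j s) (d₀ + u • (cd.Qb y d + cd.Qb d y + cd.Qb d d))) ∧
      (∀ i k, -cd.Kb ≤ k → k ≤ cd.Ka → max |bx.loK j s i k| |bx.hiK j s i k| ≤ cd.L1 j s * cd.κ j * cd.ω j k) ∧
      (∀ i k, -cd.Kb ≤ k → k ≤ cd.Ka → bx.loV j s i k ≤ -cd.ω j k ∧ cd.ω j k ≤ bx.hiV j s i k) ∧
      (∀ v₀ : Fin 4 → ℤ → ℝ, cd.InBall j v₀ 1 →
        ∀ y v, InBox cd (bx.lo j s + bx.loK j s + bx.loK j s) (bx.hi j s + bx.hiK j s + bx.hiK j s) y →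
          InBox cd (bx.loV j s) (bx.hiV j s) v → ∀ u ∈ Icc 0 (cd.h j s),
            InBox cd (bx.loV j s) (bx.hiV j s) (v₀ + u • (cd.Qb y v + cd.Qb v y))) ∧
      (∀ i k, -cd.Kb ≤ k → k ≤ cd.Ka → max |bx.loV j s i k| |bx.hiV j s i k| ≤ cd.L1 j s * cd.ω j k) ∧
      (∀ y v, InBox cd (bx.lo j s + bx.loK j s + bx.loK j s) (bx.hi j s + bx.hiK j s + bx.hiK j s) y →
        InBox cd (bx.loV j s) (bx.hiV j s) v → ∀ i k, -cd.Kb ≤ k → k ≤ cd.Ka →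
          |varJet cd.Qb y v (bx.pdegV + 1) i k| ≤ bx.JU j s i k) ∧
      (∀ z, InBox cd (bx.hlo 2 j s) (bx.hhi 2 j s) z → ∀ i k, -cd.Kb ≤ k → k ≤ cd.Ka → ∀ i' k', -cd.Kb ≤ k' → k' ≤ cd.Ka →
        bx.Mlo j s i' k' i k ≤ (∑ n ∈ Finset.range (bx.pdegV + 1), varJet cd.Qb z (basisSt i k) n i' k' * cd.h j s ^ n)
            - bx.JU j s i' k' * (cd.ω j k)⁻¹ * cd.h j s ^ (bx.pdegV + 1) ∧
        (∑ n ∈ Finset.range (bx.pdegV + 1), varJet cd.Qb z (basisSt i k) n i' k' * cd.h j s ^ n)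
            + bx.JU j s i' k' * (cd.ω j k)⁻¹ * cd.h j s ^ (bx.pdegV + 1) ≤ bx.Mhi j s i' k' i k) := by
  intro cd bx
  have hKb : cd.Kb = TV.base.Kb := rfl
  have hKa : cd.Ka = TV.base.Ka := rfl
  obtain ⟨L1, hco⟩ := coreVW_eq_coreStep (TV := TV) (kitOf := kitOf) (wT := wT) j s
  set ci := ciOf TV kitOf j ((TV.ctxOfW kitOf wT j).hull2 (TV.nodeVW kitOf wT j s) s) (TV.hD j s) L1 with hci
  have hok : (TV.base.coreStep ci).ok = true := by
    rw [← hco]; exact (((TV.ctxOfW kitOf wT j).subStep_ok_iff s _).1 (hC.steps j hj s hs)).1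
  have hcB : CertTables.CoefBoxOK QS2.toRealHom TV.base ci.coefB := hk.box j
  have hmt : ci.mt = TV.base.monosTable ci.coefB := hk.mt j
  have hH2 : ci.H2.size = TV.base.n := size_hull2 j s
  have hκω := fun i k hk1 hk2 => mem_κωB (TV := TV) (kitOf := kitOf) (wT := wT) (sc := sc) j i k hk1 hk2
  have hωB := fun i k hk1 hk2 => mem_ωB (TV := TV) (kitOf := kitOf) (wT := wT) (sc := sc) j i k hk1 hk2
  have hωi := fun i k hk1 hk2 => mem_ωinvB (TV := TV) (kitOf := kitOf) (wT := wT) (sc := sc) j i k hk1 hk2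
  -- field identities
  have eQ : cd.Qb = (TV.base.toCertData QS2.toRealHom).Qb := rfl
  have eh : cd.h j s = ci.h.toReal := rfl
  have ep : cd.pdeg = ci.p := rfl
  have epV : bx.pdegV = ci.pV := rfl
  have eL : cd.L1 j s = (TV.base.coreStep ci).L1.toReal := by
    show (TV.coreVW kitOf wT j s).L1.toReal = _; rw [hco]
  have elo : bx.lo j s = TV.base.vecF (vre (TV.base.coreStep ci).lo) := by show TV.base.vecF (vre (TV.coreVW kitOf wT j s).lo) = _; rw [hco]
  have ehi : bx.hi j s = TV.base.vecF (vre (TV.base.coreStep ci).hi) := by show TV.base.vecF (vre (TV.coreVW kitOf wT j s).hi) = _; rw [hco]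
  have eloK : bx.loK j s = TV.base.vecF (vre (TV.base.coreStep ci).loK) := by show TV.base.vecF (vre (TV.coreVW kitOf wT j s).loK) = _; rw [hco]
  have ehiK : bx.hiK j s = TV.base.vecF (vre (TV.base.coreStep ci).hiK) := by show TV.base.vecF (vre (TV.coreVW kitOf wT j s).hiK) = _; rw [hco]
  have eloV : bx.loV j s = TV.base.vecF (vre (TV.base.coreStep ci).loV) := by show TV.base.vecF (vre (TV.coreVW kitOf wT j s).loV) = _; rw [hco]
  have ehiV : bx.hiV j s = TV.base.vecF (vre (TV.base.coreStep ci).hiV) := by show TV.base.vecF (vre (TV.coreVW kitOf wT j s).hiV) = _; rw [hco]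
  have eJ : bx.J j s = TV.base.vecF (vre (TV.base.coreStep ci).J) := by show TV.base.vecF (vre (TV.coreVW kitOf wT j s).J) = _; rw [hco]
  have eJU : bx.JU j s = TV.base.vecF (vre (TV.base.coreStep ci).JU) := by show TV.base.vecF (vre (TV.coreVW kitOf wT j s).JU) = _; rw [hco]
  have eM : ∀ i' k' i k, bx.Mlo j s i' k' i k = (imget (TV.base.coreStep ci).M (TV.base.idx i' k') (TV.base.idx i k)).lo.toReal ∧
      bx.Mhi j s i' k' i k = (imget (TV.base.coreStep ci).M (TV.base.idx i' k') (TV.base.idx i k)).hi.toReal := fun i' k' i k => by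
    constructor
    · show (imget (TV.coreVW kitOf wT j s).M _ _).lo.toReal = _; rw [hco]
    · show (imget (TV.coreVW kitOf wT j s).M _ _).hi.toReal = _; rw [hco]
  have eH2lo : bx.hlo 2 j s = TV.base.vecF (IntervalD.loR ci.H2) := (vecF_loR_hull2 j s).symm
  have eH2hi : bx.hhi 2 j s = TV.base.vecF (IntervalD.hiR ci.H2) := (vecF_hiR_hull2 j s).symm
  have eTube : ∀ y, InTube cd bx j s y ↔ TV.base.InBoxW (TV.base.vecF (vre (TV.base.coreStep ci).lo) + TV.base.vecF (vre (TV.base.coreStep ci).loK))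
      (TV.base.vecF (vre (TV.base.coreStep ci).hi) + TV.base.vecF (vre (TV.base.coreStep ci).hiK)) y := fun y => by
    unfold InTube; rw [TV.base.inBoxW_iff hKb hKa, elo, ehi, eloK, ehiK]
  refine ⟨Or.inr ?_, ?_, ?_, ?_, ?_, ?_, ?_, ?_, ?_, ?_⟩
  · -- (E2)
    intro z hz u hu i k hk1 hk2
    rw [eH2lo, eH2hi, TV.base.inBoxW_iff hKb hKa] at hz
    rw [eh] at hu
    have h := TV.base.coreStep_E2 ci hk.coef hcB hmt hH2 hok z hz u hu i k hk1 hk2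
    rw [elo, ehi, eJ, eQ, ep]
    exact h
  · -- (J)
    intro y hy i k hk1 hk2
    rw [eTube] at hy
    rw [eJ, eQ, ep]
    exact TV.base.coreStep_J ci hk.coef hcB hmt hok y hy i k hk1 hk2
  · -- (D1κ) box
    intro i k hk1 hk2
    rw [eloK, ehiK]
    exact TV.base.coreStep_K_box ci hok hκω i k hk1 hk2
  · -- (D1κ) test
    intro d₀ hd₀ y d hy hd u hu
    rw [TV.base.inBallW_iff hKb hKa] at hd₀
    rw [eTube] at hy
    rw [eloK, ehiK, TV.base.inBoxW_iff hKb hKa] at hd ⊢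
    rw [eh] at hu
    rw [eQ]
    exact TV.base.coreStep_K_test ci hk.coef hcB hmt hok hκω d₀ hd₀ y d hy hd u hu
  · -- (D1κ) row
    intro i k hk1 hk2
    rw [eloK, ehiK, eL, mul_assoc]
    have h := TV.base.coreStep_K_row ci hok hκω i k hk1 hk2
    rw [mul_assoc] at h
    exact h
  · -- (V1) box
    intro i k hk1 hk2
    rw [eloV, ehiV]
    exact TV.base.coreStep_V_box ci hok hωB i k hk1 hk2
  · -- (V1) test
    intro v₀ hv₀ y v hy hv u hu
    rw [TV.base.inBallW_iff hKb hKa] at hv₀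
    rw [elo, ehi, eloK, ehiK, TV.base.inBoxW_iff hKb hKa] at hy
    rw [eloV, ehiV, TV.base.inBoxW_iff hKb hKa] at hv ⊢
    rw [eh] at hu
    rw [eQ]
    exact TV.base.coreStep_V_test ci hk.coef hcB hmt hok hωB v₀ hv₀ y v hy hv u hu
  · -- (V1) row
    intro i k hk1 hk2
    rw [eloV, ehiV, eL]
    exact TV.base.coreStep_V_row ci hok hωB i k hk1 hk2
  · -- (JU)
    intro y v hy hv i k hk1 hk2
    rw [elo, ehi, eloK, ehiK, TV.base.inBoxW_iff hKb hKa] at hy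
    rw [eloV, ehiV, TV.base.inBoxW_iff hKb hKa] at hv
    rw [eJU, eQ, epV]
    exact TV.base.coreStep_JU ci hk.coef hcB hmt hok y v hy hv i k hk1 hk2
  · -- (M)
    intro z hz i k hk1 hk2 i' k' hk1' hk2'
    rw [eH2lo, eH2hi, TV.base.inBoxW_iff hKb hKa] at hz
    rw [(eM i' k' i k).1, (eM i' k' i k).2, eJU, eQ, epV, eh]
    exact TV.base.coreStep_M ci hk.coef hcB hH2 hωi z hz i k hk1 hk2 i' k' hk1' hk2'

end Sub

/-! ### Assembly -/

/-- **`ChainVCore` for the interpreted records from the Booleans.** [folklore] -/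
theorem chainVCore_of_checks (hk : KitOK TV kitOf) (hC : ChecksOK TV kitOf wT) (hK : CoreChecksOK TV wT) :
    ChainVCore (TV.toCertDataVW kitOf wT sc) (TV.toBoxesW kitOf wT) := by
  intro j hj
  have hj' : j ≤ TV.base.N₀ := hj
  obtain ⟨hS, hT0, hsub⟩ := bookkeeping_of_checks (sc := sc) (kitOf := kitOf) hK hj'
  refine ⟨hS, hT0, fun s' hs => aBlock_of_checks hC hK hj' hs, fun s' hs => ?_⟩
  obtain ⟨hh, hTn⟩ := hsub s' hs
  obtain ⟨c1, c2, c3, c4, c5, c6, c7, c8, c9, c10⟩ := coreClauses_of_checks (sc := sc) hk hC hj' hs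
  exact ⟨hh, hTn, c1, c2, c3, c4, c5, c6, c7, c8, c9, c10⟩

/-- **`ChainV = ChainVCore ∧ ChainVRadii` for the interpreted records from the Booleans and the entry clause.** [folklore] -/
theorem chainV_of_checks (hk : KitOK TV kitOf) (hC : ChecksOK TV kitOf wT) (hK : CoreChecksOK TV wT)
    (hE : EntryOK TV kitOf wT sc) :
    ChainV (TV.toCertDataVW kitOf wT sc) (TV.toBoxesW kitOf wT) (TV.toRadiiW kitOf wT) :=
  ⟨chainVCore_of_checks hk hC hK, chainVRadii_of_checks hC hE (twinOK_of_kitOK hk)⟩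

end CertTablesV

end Summit.NavierStokesRegularity.NavierStokesRegularity.Theorems.TaylorModelCert
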